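import Literature.Analysis.FunctionSpaces.KolmogorovRiesz
import Mathlib.MeasureTheory.Function.ConvergenceInMeasure
import HarnessLib

/-!
# LINE 25 «compactness_transfer» (stmt-QuantumFields-23533 `BlockLipschitzL`, organ road of crux `HistoryTailL` stmt-QuantumFields-19936), item Γ1 —
# (N) «ε-NETS ⇒ LIMIT»: the GENERIC `L^p` HALF of the blow-down compactness: finite `ε`-nets ∕ a uniform translation modulus
# ⇒ an `L^p`-convergent subsequence; closed pointwise constraints (unit norm, vanishing off `K`) pass to the limit; set integrals converge

Cell `ym3-torus` (YM ladder rung R3 = continuum SU(2) Yang–Mills on the three-torus — a RUNG, NOT the Clay problem: not d = 4, not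
infinite volume, not a mass gap); WIDTH COPY «width 15» of ym3-torus-p1, gen 6; helper (`--supports` as LEAD names: 19936 ∕ 23533).  THEOREMS
ONLY (0 `def`, default heartbeats); SUMMIT-INDEPENDENT (no lattice, no gauge field): Mathlib measure theory + the tree's Kolmogorov–Riesz file
lit ✓`Literature.Analysis.FunctionSpaces.KolmogorovRiesz` (★★`exists_finset_eLpNorm_sub_lt_of_translate`, Adams Thm. 2.21, PROVED).

WHY (LEAD ★w1-19936 g9 11:21:00Z cut (ii); px14 g5 LOCATE 11:22:22Z «(Γ1-b)(Γ1-c) `Lp` half → px15»; px3 g7 (Γ1 seat) 11:24:48Z road + «(N) … say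
“px15: (N) MINE”»).  Γ1 of LINE 25 = «along a subsequence the zero-extended piecewise-constant blow-downs `f_k` of bounded-energy lattice maps converge
STRONGLY in `L²(Q; ℝ⁴)` to a unit-valued `U`».  px3 g7's (M) supplies the ONE lattice-analytic input — a uniform `L²` translation modulus of the `f_k`
from the bond energy; the tree's Kolmogorov–Riesz turns it into finite `ε`-nets; THIS FILE is everything after that, generic:
* §0 ★`exists_subseq_tendsto_of_finite_nets` (complete pseudo-emetric space: own-term `ε`-nets ⇒ convergent subsequence — total boundedness +
  `IsCompact.tendsto_subseq`), ★★`exists_subseq_tendsto_eLpNorm_of_finite_nets` (the same in `Lp G p μ`, ANY measure space: `∃ f ψ, StrictMono ψ ∧ MemLp f p μ ∧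
  eLpNorm (u (ψ n) − f) p μ → 0`);
* §1 ★★`exists_subseq_tendsto_eLpNorm_of_translate` — SEQUENTIAL KOLMOGOROV–RIESZ: EXACTLY the hypotheses of lit ✓`exists_finset_eLpNorm_sub_lt_of_translate`
  for a sequence (`μ` add-Haar, `1 ≤ p < ∞`, `K` compact, a.e.-strongly measurable, `= 0` off `K`, `eLpNorm ≤ A < ∞`, ONE uniform translation modulus)
  ⇒ an `L^p`-convergent subsequence (the tree's `C¹` core ✓`exists_subseq_tendsto_eLpNorm_of_contDiff` is the same knit for `C¹` data);
* §2 ★`mem_ae_of_tendsto_eLpNorm` (closed pointwise constraints on a set `S` survive `L^p` limits: `tendstoInMeasure_of_tendsto_eLpNorm` →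
  `TendstoInMeasure.exists_seq_tendsto_ae` → closedness), ★`norm_eq_ae_of_tendsto_eLpNorm` (`‖u n‖ = c` a.e. on `S` ⇒ `‖f‖ = c` a.e. on `S` — the
  «`S³`-valued a.e.» clause), `eq_zero_ae_of_tendsto_eLpNorm` (vanishing off `K`);
* §3 `eLpNorm_one_le_of_ae_eq_zero_off` (`‖g‖₁ ≤ ‖g‖_p·(μK)^{1−1∕p}` for `g = 0` a.e. off `K`), ★`tendsto_setIntegral_of_tendsto_eLpNorm` (strong `L^p`
  convergence on a finite-measure carrier ⇒ `∫_s u n → ∫_s f` for EVERY set `s`, via `tendsto_setIntegral_of_L1'`) — the «`D`-means of the maps converge»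
  currency;
* §4 ★★`exists_subseq_limit_of_translate` — the PACKAGE the Γ1 glue `exact`s: `∃ f ψ, StrictMono ψ ∧ MemLp f p μ ∧ (L^p-limit) ∧ (f = 0 a.e. off K) ∧
  (‖f‖ = c a.e. on S) ∧ (∀ s, ∫_s u (ψ n) → ∫_s f)`.
NOT here (zero twin): the lattice translation modulus (M) and the cell letters (px3 g7 (A)(B)), the `D`-means of GRADIENTS (c4) (px14 Tychonoff ∕ LEAD weak-`L²`),
Γ2∕Γ4∕S1″∕S2″.  HONEST SCOPE: generic functional analysis over a landed Literature theorem; NOTHING here proves Γ1, S2″, the organ, `BlockLipschitzL`,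
`HistoryTailL`, or any summit statement; YM₃ on T³ is rung R3, not Clay. [cite: Adams1975, Thm. 2.21] (Brezis 2011 Thm. 4.26 ∕ Cor. 4.27).
-/

noncomputable section

open MeasureTheory Set Filter Function Metric TopologicalSpace
open scoped ENNReal NNReal Topology

namespace Summit.QuantumFields.YangMills.Theorems.PoincareLipschitzTranslationModulusCompactness

open Literature.Analysis.FunctionSpaces

variable {E' : Type*} [NormedAddCommGroup E'] [NormedSpace ℝ E'] [MeasurableSpace E']
  [BorelSpace E'] [FiniteDimensional ℝ E']
variable {F : Type*} [NormedAddCommGroup F] [NormedSpace ℝ F] [CompleteSpace F]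

/-! ## §0 (N) Finite `ε`-nets in a complete space give a convergent subsequence -/

/-- ★ **ε-NETS ⇒ CONVERGENT SUBSEQUENCE** (pure topology): in a complete pseudo-emetric space, a
sequence that admits, for every `ε > 0`, a finite `ε`-net among its own terms has a convergent
subsequence — its range is totally bounded, hence has compact closure, and
`IsCompact.tendsto_subseq` applies. [folklore] -/
theorem exists_subseq_tendsto_of_finite_nets {α : Type*} [PseudoEMetricSpace α] [CompleteSpace α]
    (Φ : ℕ → α) (hnet : ∀ ε : ℝ≥0∞, 0 < ε → ∃ s : Finset ℕ, ∀ n, ∃ m ∈ s, edist (Φ n) (Φ m) < ε) :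
    ∃ (g : α) (ψ : ℕ → ℕ), StrictMono ψ ∧ Tendsto (Φ ∘ ψ) atTop (𝓝 g) := by
  have htb : TotallyBounded (range Φ) := by
    refine EMetric.totallyBounded_iff.2 fun ε hε => ?_
    obtain ⟨s, hs⟩ := hnet ε hε
    refine ⟨Φ '' s, s.finite_toSet.image Φ, ?_⟩
    rintro _ ⟨n, rfl⟩
    obtain ⟨m, hm, hnm⟩ := hs n
    exact mem_iUnion₂.2 ⟨Φ m, mem_image_of_mem Φ hm, by rwa [Metric.mem_eball]⟩
  have hcomp : IsCompact (closure (range Φ)) :=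
    htb.closure.isCompact_of_isClosed isClosed_closure
  obtain ⟨g, -, ψ, hψ, hlim⟩ :=
    hcomp.tendsto_subseq (x := Φ) fun n => subset_closure (mem_range_self n)
  exact ⟨g, ψ, hψ, hlim⟩

/-- ★★ **ε-NETS IN `L^p` ⇒ `L^p`-CONVERGENT SUBSEQUENCE** (any measure space, any `p`, `1 ≤ p` as a
`Fact` for the `Lp` norm): if `u : ℕ → X → G` are `L^p` functions and for every `ε > 0` finitely
many of them form an `ε`-net for all of them in the `eLpNorm p` distance, then some subsequence
converges in `L^p(μ)` to an `L^p` function (completeness of `Lp G p μ` + §0). This is the door a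
Kolmogorov–Riesz-type criterion (which PRODUCES the nets) is knitted to. [folklore] -/
theorem exists_subseq_tendsto_eLpNorm_of_finite_nets {X : Type*} [MeasurableSpace X]
    {μ : Measure X} {G : Type*} [NormedAddCommGroup G] [CompleteSpace G] {p : ℝ≥0∞}
    [Fact (1 ≤ p)] (u : ℕ → X → G) (hu : ∀ n, MemLp (u n) p μ)
    (hnet : ∀ ε : ℝ≥0∞, 0 < ε → ∃ s : Finset ℕ, ∀ n, ∃ m ∈ s, eLpNorm (u n - u m) p μ < ε) :
    ∃ (f : X → G) (ψ : ℕ → ℕ), StrictMono ψ ∧ MemLp f p μ ∧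
      Tendsto (fun n => eLpNorm (u (ψ n) - f) p μ) atTop (𝓝 0) := by
  let Φ : ℕ → Lp G p μ := fun n => (hu n).toLp (u n)
  have hnet' : ∀ ε : ℝ≥0∞, 0 < ε → ∃ s : Finset ℕ, ∀ n, ∃ m ∈ s, edist (Φ n) (Φ m) < ε := by
    intro ε hε
    obtain ⟨s, hs⟩ := hnet ε hε
    refine ⟨s, fun n => (hs n).imp fun m hm => ⟨hm.1, ?_⟩⟩
    simp only [Φ]
    rw [Lp.edist_toLp_toLp]
    exact hm.2
  obtain ⟨g, ψ, hψ, hlim⟩ := exists_subseq_tendsto_of_finite_nets Φ hnet'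
  refine ⟨g, ψ, hψ, Lp.memLp g, ?_⟩
  rw [tendsto_iff_edist_tendsto_0] at hlim
  refine hlim.congr fun n => ?_
  simp only [Function.comp_apply, Φ]
  rw [Lp.edist_def]
  exact eLpNorm_congr_ae ((hu _).coeFn_toLp.sub EventuallyEq.rfl)

/-! ## §1 (Γ1-b) From a uniform translation modulus to an `L^p`-convergent subsequence -/

/-- ★★ **Sequential Kolmogorov–Riesz–Fréchet**: a sequence `u : ℕ → E' → F` of a.e.-strongly
measurable functions vanishing off a fixed compact set `K`, uniformly bounded in `L^p(μ)`
(`1 ≤ p < ∞`, `μ` an additive Haar measure, `F` proper) and with ONE uniform translation modulus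
in `L^p`, has a subsequence converging in `L^p(μ)` to some `L^p` function. Proof: total
boundedness of the range in the complete space `Lp F p μ` is the tree's
`exists_finset_eLpNorm_sub_lt_of_translate` (Adams Thm. 2.21) at every `ε`; the closure is then
compact and `IsCompact.tendsto_subseq` extracts the subsequence (the pattern of the tree's `C¹`
core `exists_subseq_tendsto_eLpNorm_of_contDiff`, here for a general family). [cite: Adams1975, Thm. 2.21] -/
theorem exists_subseq_tendsto_eLpNorm_of_translate [ProperSpace F] (μ : Measure E')
    [μ.IsAddHaarMeasure] {p : ℝ≥0∞} (hp : 1 ≤ p) (hp' : p ≠ ∞) {K : Set E'} (hK : IsCompact K)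
    (u : ℕ → E' → F) (hum : ∀ n, AEStronglyMeasurable (u n) μ)
    (huK : ∀ n x, x ∉ K → u n x = 0) {A : ℝ≥0∞} (hA : A ≠ ∞) (huA : ∀ n, eLpNorm (u n) p μ ≤ A)
    (hmod : ∀ ε : ℝ≥0∞, 0 < ε → ∃ δ : ℝ, 0 < δ ∧
      ∀ n, ∀ y : E', ‖y‖ ≤ δ → eLpNorm (fun x => u n (x - y) - u n x) p μ ≤ ε) :
    ∃ (f : E' → F) (ψ : ℕ → ℕ), StrictMono ψ ∧ MemLp f p μ ∧
      Tendsto (fun n => eLpNorm (u (ψ n) - f) p μ) atTop (𝓝 0) := by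
  haveI : Fact (1 ≤ p) := ⟨hp⟩
  have hmem : ∀ n, MemLp (u n) p μ := fun n => ⟨hum n, (huA n).trans_lt hA.lt_top⟩
  exact exists_subseq_tendsto_eLpNorm_of_finite_nets u hmem fun ε hε =>
    exists_finset_eLpNorm_sub_lt_of_translate μ hp hp' hK u hum huK hA huA hmod hε

/-! ## §2 (Γ1-c) Closed pointwise constraints pass to `L^p` limits -/

section Constraint

variable {X : Type*} [MeasurableSpace X] {μ : Measure X} {G : Type*} [NormedAddCommGroup G]

/-- ★ **Closed pointwise constraints survive `L^p` limits.** If `u n → f` in `L^p(μ)` (`p ≠ 0`)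
and, for every `n`, `u n x ∈ C` for a.e. `x ∈ S` with `C` closed, then `f x ∈ C` for a.e.
`x ∈ S`: convergence in `L^p` gives convergence in measure
(`tendstoInMeasure_of_tendsto_eLpNorm`), hence a.e. convergence along a subsequence
(`TendstoInMeasure.exists_seq_tendsto_ae`), and `C` is closed. [folklore] -/
theorem mem_ae_of_tendsto_eLpNorm {p : ℝ≥0∞} (hp : p ≠ 0) (u : ℕ → X → G) (f : X → G)
    (hum : ∀ n, AEStronglyMeasurable (u n) μ) (hf : AEStronglyMeasurable f μ)
    (hlim : Tendsto (fun n => eLpNorm (u n - f) p μ) atTop (𝓝 0))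
    {S : Set X} {C : Set G} (hC : IsClosed C) (hmem : ∀ n, ∀ᵐ x ∂μ, x ∈ S → u n x ∈ C) :
    ∀ᵐ x ∂μ, x ∈ S → f x ∈ C := by
  have hmeas : TendstoInMeasure μ u atTop f := tendstoInMeasure_of_tendsto_eLpNorm hp hum hf hlim
  obtain ⟨ns, -, hns⟩ := hmeas.exists_seq_tendsto_ae
  have hall : ∀ᵐ x ∂μ, ∀ n, x ∈ S → u n x ∈ C := ae_all_iff.2 hmem
  filter_upwards [hns, hall] with x hx hx' hxS
  exact hC.mem_of_tendsto hx (Eventually.of_forall fun i => hx' (ns i) hxS)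

/-- ★ **Unit (or constant-norm) constraints survive `L^p` limits**: if `‖u n x‖ = c` for a.e.
`x ∈ S` and `u n → f` in `L^p(μ)`, then `‖f x‖ = c` for a.e. `x ∈ S` (the sphere is closed).
For `c = 1` and `G = ℝ⁴` this is the «`S³`-valued a.e.» clause of the blow-down limit.
[folklore] -/
theorem norm_eq_ae_of_tendsto_eLpNorm {p : ℝ≥0∞} (hp : p ≠ 0) (u : ℕ → X → G) (f : X → G)
    (hum : ∀ n, AEStronglyMeasurable (u n) μ) (hf : AEStronglyMeasurable f μ)
    (hlim : Tendsto (fun n => eLpNorm (u n - f) p μ) atTop (𝓝 0))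
    {S : Set X} {c : ℝ} (hnorm : ∀ n, ∀ᵐ x ∂μ, x ∈ S → ‖u n x‖ = c) :
    ∀ᵐ x ∂μ, x ∈ S → ‖f x‖ = c := by
  have h := mem_ae_of_tendsto_eLpNorm hp u f hum hf hlim (C := {v : G | ‖v‖ = c})
    (isClosed_eq continuous_norm continuous_const) hnorm
  simpa using h

/-- **Vanishing off a set survives `L^p` limits**: if every `u n` vanishes a.e. off `K` and
`u n → f` in `L^p(μ)`, then `f = 0` a.e. off `K`. [folklore] -/
theorem eq_zero_ae_of_tendsto_eLpNorm {p : ℝ≥0∞} (hp : p ≠ 0) (u : ℕ → X → G) (f : X → G)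
    (hum : ∀ n, AEStronglyMeasurable (u n) μ) (hf : AEStronglyMeasurable f μ)
    (hlim : Tendsto (fun n => eLpNorm (u n - f) p μ) atTop (𝓝 0))
    {K : Set X} (hzero : ∀ n, ∀ᵐ x ∂μ, x ∉ K → u n x = 0) :
    ∀ᵐ x ∂μ, x ∉ K → f x = 0 := by
  have h := mem_ae_of_tendsto_eLpNorm hp u f hum hf hlim (S := Kᶜ) (C := {(0 : G)})
    isClosed_singleton (fun n => by simpa using hzero n)
  simpa using h

end Constraint

/-! ## §3 (Γ1-d) Strong `L^p` convergence on a compact carrier, read on sets -/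

section SetIntegral

variable {X : Type*} [MeasurableSpace X] {μ : Measure X}
variable {G : Type*} [NormedAddCommGroup G]

/-- `L¹` is dominated by `L^p` on a carrier of finite measure: if `g` vanishes a.e. off `K`,
`μ K < ∞` and `1 ≤ p`, then `‖g‖₁ ≤ ‖g‖_p · (μ K)^{1 - 1/p}`. [folklore] -/
theorem eLpNorm_one_le_of_ae_eq_zero_off {p : ℝ≥0∞} (hp : 1 ≤ p) {K : Set X}
    (hK : MeasurableSet K) {g : X → G} (hg : AEStronglyMeasurable g μ)
    (hzero : ∀ᵐ x ∂μ, x ∉ K → g x = 0) :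
    eLpNorm g 1 μ ≤ eLpNorm g p μ * μ K ^ (1 - 1 / p.toReal) := by
  have hind : g =ᵐ[μ] K.indicator g := by
    filter_upwards [hzero] with x hx
    by_cases hxK : x ∈ K
    · rw [indicator_of_mem hxK]
    · rw [indicator_of_notMem hxK, hx hxK]
  calc eLpNorm g 1 μ = eLpNorm (K.indicator g) 1 μ := eLpNorm_congr_ae hind
    _ = eLpNorm g 1 (μ.restrict K) := eLpNorm_indicator_eq_eLpNorm_restrict hK
    _ ≤ eLpNorm g p (μ.restrict K) * (μ.restrict K) Set.univ ^ (1 / (1 : ℝ≥0∞).toReal - 1 / p.toReal) :=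
        eLpNorm_le_eLpNorm_mul_rpow_measure_univ hp hg.restrict
    _ ≤ eLpNorm g p μ * μ K ^ (1 - 1 / p.toReal) := by
        rw [Measure.restrict_apply_univ, ENNReal.toReal_one, div_one]
        exact mul_le_mul_left (eLpNorm_mono_measure g Measure.restrict_le_self) _

variable [NormedSpace ℝ G]

/-- ★ **Strong `L^p` convergence on a compact carrier gives convergence of all set integrals.**
If `u n → f` in `L^p(μ)` (`1 ≤ p`), every `u n` and `f` vanish a.e. off a set `K` of finite
measure, then `∫_{s} u n → ∫_{s} f` for EVERY set `s` (via `L¹` convergence,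
`tendsto_setIntegral_of_L1'`). [folklore] -/
theorem tendsto_setIntegral_of_tendsto_eLpNorm {p : ℝ≥0∞} (hp : 1 ≤ p) {K : Set X}
    (hK : MeasurableSet K) (hμK : μ K ≠ ∞) (u : ℕ → X → G) (f : X → G)
    (hu : ∀ n, MemLp (u n) p μ) (hf : MemLp f p μ)
    (huK : ∀ n, ∀ᵐ x ∂μ, x ∉ K → u n x = 0) (hfK : ∀ᵐ x ∂μ, x ∉ K → f x = 0)
    (hlim : Tendsto (fun n => eLpNorm (u n - f) p μ) atTop (𝓝 0)) (s : Set X) :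
    Tendsto (fun n => ∫ x in s, u n x ∂μ) atTop (𝓝 (∫ x in s, f x ∂μ)) := by
  haveI : IsFiniteMeasure (μ.restrict K) := isFiniteMeasure_restrict.2 hμK
  -- integrability of `u n`: `L^p` on the finite-measure carrier, zero off it
  have hint : ∀ n, Integrable (u n) μ := by
    intro n
    have h1 : Integrable (u n) (μ.restrict K) := ((hu n).restrict K).integrable hp
    have h2 : Integrable (K.indicator (u n)) μ := (integrable_indicator_iff hK).2 h1
    refine h2.congr ?_
    filter_upwards [huK n] with x hx
    by_cases hxK : x ∈ K
    · rw [indicator_of_mem hxK]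
    · rw [indicator_of_notMem hxK, hx hxK]
  refine tendsto_setIntegral_of_L1' f hf.1 (Eventually.of_forall hint) ?_ s
  -- `L¹` convergence from `L^p` convergence on the carrier
  have hdiff0 : ∀ n, ∀ᵐ x ∂μ, x ∉ K → (u n - f) x = 0 := fun n => by
    filter_upwards [huK n, hfK] with x hu' hf' hxK
    simp [hu' hxK, hf' hxK]
  have hle : ∀ n, eLpNorm (u n - f) 1 μ ≤ eLpNorm (u n - f) p μ * μ K ^ (1 - 1 / p.toReal) :=
    fun n => eLpNorm_one_le_of_ae_eq_zero_off hp hK ((hu n).1.sub hf.1) (hdiff0 n)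
  have hC : μ K ^ (1 - 1 / p.toReal) ≠ ∞ := by
    refine ENNReal.rpow_ne_top_of_nonneg ?_ hμK
    have h1 : 1 ≤ p.toReal ∨ p = ∞ := by
      rcases eq_or_ne p ∞ with h | h
      · exact Or.inr h
      · left; rw [← ENNReal.toReal_one]; exact ENNReal.toReal_mono h hp
    rcases h1 with h1 | h1
    · have : 1 / p.toReal ≤ 1 := by rw [div_le_one (by linarith)]; exact h1
      linarith
    · rw [h1, ENNReal.toReal_top, div_zero]; norm_num
  have hlim' : Tendsto (fun n => eLpNorm (u n - f) p μ * μ K ^ (1 - 1 / p.toReal)) atTop (𝓝 0) := by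
    have := ENNReal.Tendsto.mul_const hlim (Or.inr hC)
    rwa [zero_mul] at this
  exact tendsto_of_tendsto_of_tendsto_of_le_of_le tendsto_const_nhds hlim'
    (fun _ => bot_le) hle

end SetIntegral

/-! ## §4 The package the Γ1 glue consumes -/

/-- ★★ **(Γ1-b)+(Γ1-c)+(Γ1-d) packaged**: a uniformly `L^p`-bounded sequence of unit-norm-on-`S`
maps vanishing off a compact `K`, with one uniform `L^p` translation modulus, has a subsequence
converging in `L^p` to an `L^p` map `f` that vanishes a.e. off `K`, has `‖f‖ = c` a.e. on `S`,
and whose set integrals are the limits of the set integrals along the subsequence. [cite: Adams1975, Thm. 2.21] -/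
theorem exists_subseq_limit_of_translate [ProperSpace F] (μ : Measure E') [μ.IsAddHaarMeasure]
    {p : ℝ≥0∞} (hp : 1 ≤ p) (hp' : p ≠ ∞) {K : Set E'} (hK : IsCompact K)
    (u : ℕ → E' → F) (hum : ∀ n, AEStronglyMeasurable (u n) μ)
    (huK : ∀ n x, x ∉ K → u n x = 0) {A : ℝ≥0∞} (hA : A ≠ ∞) (huA : ∀ n, eLpNorm (u n) p μ ≤ A)
    (hmod : ∀ ε : ℝ≥0∞, 0 < ε → ∃ δ : ℝ, 0 < δ ∧
      ∀ n, ∀ y : E', ‖y‖ ≤ δ → eLpNorm (fun x => u n (x - y) - u n x) p μ ≤ ε)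
    {S : Set E'} {c : ℝ} (hnorm : ∀ n, ∀ᵐ x ∂μ, x ∈ S → ‖u n x‖ = c) :
    ∃ (f : E' → F) (ψ : ℕ → ℕ), StrictMono ψ ∧ MemLp f p μ ∧
      Tendsto (fun n => eLpNorm (u (ψ n) - f) p μ) atTop (𝓝 0) ∧
      (∀ᵐ x ∂μ, x ∉ K → f x = 0) ∧ (∀ᵐ x ∂μ, x ∈ S → ‖f x‖ = c) ∧
      ∀ s : Set E', Tendsto (fun n => ∫ x in s, u (ψ n) x ∂μ) atTop (𝓝 (∫ x in s, f x ∂μ)) := by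
  obtain ⟨f, ψ, hψ, hf, hlim⟩ :=
    exists_subseq_tendsto_eLpNorm_of_translate μ hp hp' hK u hum huK hA huA hmod
  have hp0 : p ≠ 0 := (zero_lt_one.trans_le hp).ne'
  have humψ : ∀ n, AEStronglyMeasurable (u (ψ n)) μ := fun n => hum (ψ n)
  have hfK : ∀ᵐ x ∂μ, x ∉ K → f x = 0 :=
    eq_zero_ae_of_tendsto_eLpNorm hp0 (fun n => u (ψ n)) f humψ hf.1 hlim
      fun n => Eventually.of_forall fun x hx => huK (ψ n) x hx
  refine ⟨f, ψ, hψ, hf, hlim, hfK, ?_, ?_⟩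
  · exact norm_eq_ae_of_tendsto_eLpNorm hp0 (fun n => u (ψ n)) f humψ hf.1 hlim
      fun n => hnorm (ψ n)
  · have hmem : ∀ n, MemLp (u (ψ n)) p μ := fun n => ⟨hum _, (huA _).trans_lt hA.lt_top⟩
    exact tendsto_setIntegral_of_tendsto_eLpNorm hp hK.isClosed.measurableSet
      hK.measure_lt_top.ne (fun n => u (ψ n)) f hmem hf
      (fun n => Eventually.of_forall fun x hx => huK (ψ n) x hx) hfK hlim

end Summit.QuantumFields.YangMills.Theorems.PoincareLipschitzTranslationModulusCompactness

end
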